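import Summits.QuantumFields.YangMills.Theses.HyperbolicRegulator
import Literature.Probability.LatticeModels.GibbsSpecificationProofs

/-!
# `HyperbolicToTorusR` (stmt-QuantumFields-18156) — Negative: on line `replica_rooting`, stub (EXT)
# `ExtremalInvariantStates` already contains translation-invariant UNIQUENESS; stub (PTU) is redundant

Refuter (cdisprove `refuter-cdisprove-stmt-QuantumFields-18156-0`, 2026-08-17) support lemma for the crux
`Summit.QuantumFields.YangMills.Theses.HyperbolicRegulator.HyperbolicToTorusR` (route `HyperbolicRegulator`, rank 4),
extracted from the standing disprover's work file `Cruxes/HyperbolicToTorusR/Disproof.lean` §3 (cycle 1).  Bodies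
inline (no auxiliary `def … : Prop`); tree objects only; nothing here asserts a statement of the route.

The registered skeleton `Cruxes/HyperbolicToTorusR/Lines/replica_rooting.lean` composes the crux from five stubs
(H₂) `RootedPairLimit`, (PTU) `PressureTangentUnique`, (EXT) `ExtremalInvariantStates`, (RT) `ReplicaDecoupling`,
(V) `TorusFiniteSize`; (PTU) enters ONLY to produce, through the landed tangent bridge, the agreement U_tr(β) of all
translation-invariant DLR states on species, which is the first hypothesis of (RT); (EXT) — "every
translation-invariant DLR state of Wilson's specification at `β ≥ βe` is extremal" — is its second hypothesis.

* `eq_of_midpoint_mem_extremePoints` — in an `ℝ≥0∞`-module, if the midpoint `½x₁ + ½x₂` of two points of `A` is an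
  extreme point of `A` then `x₁ = x₂` (Mathlib `mem_extremePoints`, `ENNReal.inv_two_add_inv_two`).
* `midpoint_mem_ymGibbsMeasures_and_transInv` — the midpoint of two translation-invariant DLR states of
  `ymSpecification ρ β` is a translation-invariant DLR state (tree `convex_gibbsMeasures_holds`; `Measure.map_add`).
* `transInv_unique_of_extremal` — **EXT(β) ⇒ at most ONE translation-invariant DLR state at `β`** (any `d`, `ρ`,
  `β`): the midpoint is an extreme point of `𝒢(β)` in the open segment between the two states.
* `not_extremal_of_two_transInv_states` — contrapositive: two distinct translation-invariant DLR states refute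
  EXT(β) (the only visible failure mode of the stub).
* `speciesIntegral_eq_of_extremal` — **EXT(β) ⇒ U_tr(β)** in the exact shape of (RT)'s first hypothesis.
* `utrAll_of_extremalInvariantStates` — the skeleton-level statement: the body of stub (EXT) (VERBATIM
  `ReplicaRooting.ExtremalInvariantStates`) implies "`∃ βu ∀ β ≥ βu`, U_tr(β)" for every compact simple `G` and
  faithful `r`; so `HyperbolicToTorusR_of` needs only (H₂), (EXT), (RT), (V) (checked in the work file as
  `hyperbolicToTorusR_of_four_stubs`), and (EXT) must be read as what it is: uniqueness AND purity of the
  homogeneous phase of 4D Wilson theory at weak coupling — the line's open core together with (V).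

Negative/support lane, `--supports stmt-QuantumFields-18156`. [folklore]
-/

noncomputable section

namespace Summit.QuantumFields.YangMills.Theorems.HyperbolicToTorusR.Negative

open scoped ENNReal
open MeasureTheory
open Literature.MathematicalPhysics.QuantumFieldTheory (LatticeRep YMSpecies IsCompactSimpleLieGroup)
open Literature.Probability.LatticeModels (IsExtremalGibbs gibbsMeasures convex_gibbsMeasures_holds)
open Literature.MathematicalPhysics.QuantumLattice (LGConfig configShift IsZdTranslationInvariant ymSpecification
  ymGibbsMeasures)

/-- **Abstract core.**  In an `ℝ≥0∞`-module, if the midpoint `½x₁ + ½x₂` of two points of `A` is an extreme point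
of `A`, then `x₁ = x₂`. [folklore] -/
theorem eq_of_midpoint_mem_extremePoints {M : Type*} [AddCommMonoid M] [Module ℝ≥0∞ M] {A : Set M} {x₁ x₂ : M}
    (h₁ : x₁ ∈ A) (h₂ : x₂ ∈ A)
    (h : (2⁻¹ : ℝ≥0∞) • x₁ + (2⁻¹ : ℝ≥0∞) • x₂ ∈ Set.extremePoints ℝ≥0∞ A) : x₁ = x₂ := by
  have hseg : (2⁻¹ : ℝ≥0∞) • x₁ + (2⁻¹ : ℝ≥0∞) • x₂ ∈ openSegment ℝ≥0∞ x₁ x₂ :=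
    ⟨2⁻¹, 2⁻¹, by simp, by simp, ENNReal.inv_two_add_inv_two, rfl⟩
  have h12 := (mem_extremePoints.1 h).2 x₁ h₁ x₂ h₂ hseg
  exact h12.1.trans h12.2.symm

variable {d N : ℕ} {G : Type*} [Group G] [TopologicalSpace G] [IsTopologicalGroup G] [CompactSpace G]
  [MeasurableSpace G] [BorelSpace G] (ρ : G →* Matrix (Fin N) (Fin N) ℂ) (β : ℝ)

/-- The midpoint of two translation-invariant DLR states of Wilson's specification is a translation-invariant DLR
state (convexity of `𝒢(β)`, linearity of push-forward). [folklore] -/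
theorem midpoint_mem_ymGibbsMeasures_and_transInv {μ₁ μ₂ : Measure (LGConfig d G)}
    (h₁ : μ₁ ∈ ymGibbsMeasures (d := d) ρ β) (h₂ : μ₂ ∈ ymGibbsMeasures (d := d) ρ β)
    (t₁ : IsZdTranslationInvariant μ₁) (t₂ : IsZdTranslationInvariant μ₂) :
    (2⁻¹ : ℝ≥0∞) • μ₁ + (2⁻¹ : ℝ≥0∞) • μ₂ ∈ ymGibbsMeasures (d := d) ρ β ∧
      IsZdTranslationInvariant ((2⁻¹ : ℝ≥0∞) • μ₁ + (2⁻¹ : ℝ≥0∞) • μ₂) := by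
  refine ⟨convex_gibbsMeasures_holds (ymSpecification (d := d) ρ β) h₁ h₂ (by simp) (by simp)
    ENNReal.inv_two_add_inv_two, fun v => ?_⟩
  rw [Measure.map_add _ _ (configShift v).measurable, Measure.map_smul, Measure.map_smul, t₁ v, t₂ v]

/-- **EXT(β) ⇒ at most one translation-invariant DLR state at `β`.**  If every translation-invariant DLR state of
`ymSpecification ρ β` is extremal (the body of stub (EXT) at `β`), any two translation-invariant DLR states
coincide: their midpoint is again one, hence an extreme point of `𝒢(β)` lying in the open segment between them.
[folklore] -/
theorem transInv_unique_of_extremal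
    (hE : ∀ μ : Measure (LGConfig d G), μ ∈ ymGibbsMeasures (d := d) ρ β → IsZdTranslationInvariant μ →
      IsExtremalGibbs (ymSpecification (d := d) ρ β) μ)
    {μ₁ μ₂ : Measure (LGConfig d G)} (h₁ : μ₁ ∈ ymGibbsMeasures (d := d) ρ β)
    (h₂ : μ₂ ∈ ymGibbsMeasures (d := d) ρ β) (t₁ : IsZdTranslationInvariant μ₁) (t₂ : IsZdTranslationInvariant μ₂) :
    μ₁ = μ₂ := by
  obtain ⟨hG, hT⟩ := midpoint_mem_ymGibbsMeasures_and_transInv ρ β h₁ h₂ t₁ t₂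
  exact eq_of_midpoint_mem_extremePoints h₁ h₂ (hE _ hG hT)

/-- **Contrapositive — the stub's only visible failure mode:** two DISTINCT translation-invariant DLR states at
`β` refute EXT(β). [folklore] -/
theorem not_extremal_of_two_transInv_states {μ₁ μ₂ : Measure (LGConfig d G)}
    (h₁ : μ₁ ∈ ymGibbsMeasures (d := d) ρ β) (h₂ : μ₂ ∈ ymGibbsMeasures (d := d) ρ β)
    (t₁ : IsZdTranslationInvariant μ₁) (t₂ : IsZdTranslationInvariant μ₂) (hne : μ₁ ≠ μ₂) :
    ¬ ∀ μ : Measure (LGConfig d G), μ ∈ ymGibbsMeasures (d := d) ρ β → IsZdTranslationInvariant μ →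
      IsExtremalGibbs (ymSpecification (d := d) ρ β) μ :=
  fun hE => hne (transInv_unique_of_extremal ρ β hE h₁ h₂ t₁ t₂)

/-- **EXT(β) ⇒ U_tr(β)** — in the exact shape of the first hypothesis of stub (RT) `ReplicaDecoupling`:
translation-invariant DLR states agree on every species. [folklore] -/
theorem speciesIntegral_eq_of_extremal
    (hE : ∀ μ : Measure (LGConfig d G), μ ∈ ymGibbsMeasures (d := d) ρ β → IsZdTranslationInvariant μ →
      IsExtremalGibbs (ymSpecification (d := d) ρ β) μ) {α : Type*} (f : α → LGConfig d G → ℝ) :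
    ∀ μ ν : Measure (LGConfig d G), μ ∈ ymGibbsMeasures (d := d) ρ β → ν ∈ ymGibbsMeasures (d := d) ρ β →
      IsZdTranslationInvariant μ → IsZdTranslationInvariant ν → ∀ X : α, ∫ U, f X U ∂μ = ∫ U, f X U ∂ν := by
  intro μ ν hμ hν hμT hνT X
  rw [transInv_unique_of_extremal ρ β hE hμ hν hμT hνT]

omit ρ β in
/-- **Skeleton level: stub (EXT) implies the U_tr statement that stub (PTU) + the tangent bridge were there to
supply.**  The hypothesis is VERBATIM the body of `ReplicaRooting.ExtremalInvariantStates`; the conclusion is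
U_tr(β) for all `β ≥ βe`, for every compact simple `G` and faithful unitary `r`, in the shape consumed by
`ReplicaRooting.HyperbolicToTorusR_of`.  Hence (PTU) is redundant on the line. [folklore] -/
theorem utrAll_of_extremalInvariantStates
    (hE : ∀ (G : Type) [Group G] [TopologicalSpace G] [IsTopologicalGroup G] [CompactSpace G]
      [MeasurableSpace G] [BorelSpace G], IsCompactSimpleLieGroup G → ∀ r : LatticeRep G,
      ∃ βe : ℝ, ∀ β : ℝ, βe ≤ β → ∀ μ : MeasureTheory.Measure (LGConfig 4 G),
        μ ∈ ymGibbsMeasures (d := 4) r.ρ β → IsZdTranslationInvariant μ →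
          IsExtremalGibbs (ymSpecification (d := 4) r.ρ β) μ) :
    ∀ (G : Type) [Group G] [TopologicalSpace G] [IsTopologicalGroup G] [CompactSpace G]
      [MeasurableSpace G] [BorelSpace G], IsCompactSimpleLieGroup G → ∀ r : LatticeRep G,
      ∃ βu : ℝ, ∀ β : ℝ, βu ≤ β → ∀ μ ν : MeasureTheory.Measure (LGConfig 4 G),
        μ ∈ ymGibbsMeasures (d := 4) r.ρ β → ν ∈ ymGibbsMeasures (d := 4) r.ρ β →
          IsZdTranslationInvariant μ → IsZdTranslationInvariant ν →
            ∀ X : YMSpecies G, ∫ U, X.F U ∂μ = ∫ U, X.F U ∂ν := by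
  intro G _ _ _ _ _ _ hG r
  obtain ⟨βe, hβe⟩ := hE G hG r
  exact ⟨βe, fun β hβ => speciesIntegral_eq_of_extremal r.ρ β (hβe β hβ) fun (X : YMSpecies G) U => X.F U⟩

end Summit.QuantumFields.YangMills.Theorems.HyperbolicToTorusR.Negative

end
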